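import Summits.FinalStateConjecture.FinalStateConjecture.Theorems.PhotonSphereChannelsDarkFutureDefs
import Literature.Geometry.Lorentzian.Isometry
import Literature.Geometry.Lorentzian.KerrData
import Literature.Geometry.Lorentzian.KerrBackwardsIsometryProofs
import HarnessLib

/-!
# Route PhotonSphereChannels · crux `ChannelsResolveTameDevelopmentsR` ·
# line `dark-future-exactness` · Glue G4b: an injective local isometry of the sub-extremal
# Kerr exterior can be re-chosen future-oriented on `{r > 2M}`

The eternal-stationary-exterior rigidity statement returns an injective local isometry `Ψ` of the
smooth Kerr exterior `(Kerr.exterior M a, Kerr.smoothMetric M a r₊)` onto a region `O` of a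
spacetime `𝓢` in EITHER time orientation, while the line's `IsKerrDoc` wants `Ψ_* ∂_{t*}`
FUTURE-directed on `{r > 2M}`. The fix (this file): `g_{M,a}(∂_{t*}, ∂_{t*}) = −1 + 2H` with
`H = M r³/(r⁴ + a²z²) ≤ M/r < 1/2` for `r > 2M`, so by the isometry identity `Ψ_* ∂_{t*}` is
timelike on `S = {x | 2M < r(x)}`; the orientation functional `x ↦ g(T(Ψ x), Ψ_* ∂_{t*})` (`T` the
orienting field of `𝓢`) is continuous (the metric is a continuous section of the bundle of
bilinear forms, Mathlib `ContMDiff.clm_bundle_apply₂` at regularity `0`) and nonvanishing on the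
connected set `S` (the continuous image of the connected chart domain `Kerr.region a (2M)`,
`2M ≥ r₊`), hence of one sign there. In the past case replace `Ψ` by `Ψ ∘ ι`, `ι` the backwards
isometry `Kerr.Backwards.exteriorMap M a` of O'Neill 1995, Ch. 3, §3.1 (an involutive smooth
isometric immersion, hence a diffeomorphism and a local isometry, with `dι ∂_{t*} = −∂_{t*}` and
`r ∘ ι = r`): `Ψ ∘ ι` is injective with the same range, a local isometry (composition), and
`(Ψ ∘ ι)_* ∂_{t*} = −Ψ_* ∂_{t*}` is future-directed.

References: B. O'Neill, *Semi-Riemannian Geometry* (1983), Ch. 3, pp. 90–91 (local isometries),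
Ch. 5, Lemma 5.26 ff., p. 145 (timecones, time orientation); B. O'Neill, *The Geometry of Kerr
Black Holes* (1995), Ch. 3, §3.1 (the backwards isometry); M. Visser, arXiv:0706.0622, (32)–(35)
(Kerr–Schild form).
-/

noncomputable section

-- the operator-norm instance on `E4 →L[ℝ] E4 →L[ℝ] ℝ` needs one more level of pending
-- instance problems than the default (as in `TameHullDefs`)
set_option maxSynthPendingDepth 3
-- every `Summit.FinalStateConjecture.FinalStateConjecture.…` name repeats the summit segment
-- (D-0017 layout)
set_option linter.dupNamespace false

open Set Filter Function TopologicalSpace Manifold Bundle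
open scoped Topology Manifold ContDiff ENNReal NNReal

namespace Summit.FinalStateConjecture.FinalStateConjecture.Theorems.DarkFuture

open Literature.Geometry.Lorentzian
open Summit.FinalStateConjecture.FinalStateConjecture.Theorems.TameHull

/-! ## Ingredients -/

/-- **`∂_{t*}` is timelike for the Kerr–Schild form where `r > 2M`** (`M > 0`):
`g_{M,a}(∂_{t*}, ∂_{t*}) = −1 + 2H` with `H = M r³/(r⁴ + a² z²) ≤ M/r < 1/2`. Visser
arXiv:0706.0622, (32)–(33); DRSR arXiv:1402.7034, §2.2.4 (the ergoregion `{−1 + 2H > 0}` lies in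
`{r ≤ 2M}`). [cite: arXiv07060622, (32)–(33)] -/
theorem Kerr_bilin_basisVector_zero_neg_of_lt_radius {M a : ℝ} (hM : 0 < M) {x : E4}
    (hx : 2 * M < Kerr.radius a x) :
    Kerr.bilin M a x (E4.basisVector 0) (E4.basisVector 0) < 0 := by
  have hr : 0 < Kerr.radius a x := lt_trans (by positivity) hx
  have hH : Kerr.scalarH M a x ≤ M / Kerr.radius a x := Kerr.scalarH_le_div hM.le a hr
  have hlt : M / Kerr.radius a x < 1 / 2 := by
    rw [div_lt_div_iff₀ hr two_pos]
    linarith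
  have h2H : 2 * Kerr.scalarH M a x < 1 := by linarith
  rw [Kerr.bilin_apply, Minkowski.bilin_basisVector_zero, Kerr.nullCovector_basisVector_zero,
    mul_one, mul_one]
  linarith

/-- **Continuity of the orientation functional.** For a smooth chart map `Ψ : U → 𝓢` on an open
`U ⊆ E4` and a constant vector `v`, the function `x ↦ g_{Ψ x}(T(Ψ x), dΨ_x v)` (`T` the orienting
field of `𝓢`) is continuous: the metric is a continuous section of the bundle of bilinear forms,
`x ↦ (Ψ x, T(Ψ x))` and `x ↦ (Ψ x, dΨ_x v)` are continuous into `T𝓢` (tangent map of `Ψ` on the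
constant section of `TU`, `OpensChart.contMDiffAt_section_iff`), and Mathlib's
`ContMDiff.clm_bundle_apply₂` at regularity `0` evaluates. O'Neill 1983, Ch. 3, Def. 3.1.
[cite: ONeill1983, Ch. 3, Def. 3.1] -/
theorem continuous_val_vectorField_mfderiv_const {𝓢 : Spacetime.{0} 4} {U : Opens E4}
    {Ψ : U → 𝓢.carrier} (hΨ : ContMDiff 𝓘(ℝ, E4) (𝓡 4) ∞ Ψ) (v : E4) :
    Continuous fun x : U ↦ 𝓢.metric.val (Ψ x) (𝓢.timeOrientation.vectorField (Ψ x))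
      (mfderiv 𝓘(ℝ, E4) (𝓡 4) Ψ x v) := by
  -- adapted from `TameCensorshipUnwind.stub_continuous_val_vectorField_mfderiv` (constant field)
  have h1n : (1 : ℕ∞ω) ≤ ((⊤ : ℕ∞) : ℕ∞ω) := WithTop.coe_le_coe.mpr le_top
  -- the constant section `x ↦ (x, v)` of `TU` is smooth
  have hsec : ContMDiff 𝓘(ℝ, E4) 𝓘(ℝ, E4).tangent ∞
      (fun x : U ↦ (⟨x, v⟩ : TangentBundle 𝓘(ℝ, E4) U)) :=
    fun x ↦ (OpensChart.contMDiffAt_section_iff x (fun _ : U ↦ (v : E4))).2 contMDiffAt_const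
  -- the push-forward `x ↦ (Ψ x, dΨ v)` is continuous into `T𝓢`
  have hW : Continuous (fun x : U ↦
      (⟨Ψ x, mfderiv 𝓘(ℝ, E4) (𝓡 4) Ψ x v⟩ : TangentBundle (𝓡 4) 𝓢.carrier)) :=
    (hΨ.continuous_tangentMap h1n).comp hsec.continuous
  -- the orienting field along `Ψ` is continuous into `T𝓢`
  have hT : Continuous (fun x : U ↦
      (⟨Ψ x, 𝓢.timeOrientation.vectorField (Ψ x)⟩ : TangentBundle (𝓡 4) 𝓢.carrier)) :=
    (contMDiff_zero_iff.mp (𝓢.timeOrientation.contMDiff.of_le bot_le)).comp hΨ.continuous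
  -- evaluate the metric (a `C⁰` section of the bundle of bilinear forms) on the two lifts
  have hg0 : ContMDiff (𝓡 4) ((𝓡 4).prod 𝓘(ℝ, E4 →L[ℝ] E4 →L[ℝ] ℝ)) 0
      (fun b ↦ TotalSpace.mk' (E4 →L[ℝ] E4 →L[ℝ] ℝ) b (𝓢.metric.val b)) :=
    𝓢.metric.contMDiff.of_le bot_le
  have hc0 : ContMDiff 𝓘(ℝ, E4) (𝓡 4) 0 Ψ := hΨ.of_le bot_le
  have hT0 : ContMDiff 𝓘(ℝ, E4) (𝓡 4).tangent 0 (fun x : U ↦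
      (⟨Ψ x, 𝓢.timeOrientation.vectorField (Ψ x)⟩ : TangentBundle (𝓡 4) 𝓢.carrier)) :=
    contMDiff_zero_iff.mpr hT
  have hW0 : ContMDiff 𝓘(ℝ, E4) (𝓡 4).tangent 0 (fun x : U ↦
      (⟨Ψ x, mfderiv 𝓘(ℝ, E4) (𝓡 4) Ψ x v⟩ : TangentBundle (𝓡 4) 𝓢.carrier)) :=
    contMDiff_zero_iff.mpr hW
  have h : ContMDiff 𝓘(ℝ, E4) ((𝓡 4).prod 𝓘(ℝ, ℝ)) 0
      (fun x : U ↦ TotalSpace.mk' ℝ (E := Bundle.Trivial 𝓢.carrier ℝ) (Ψ x)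
        (𝓢.metric.val (Ψ x) (𝓢.timeOrientation.vectorField (Ψ x))
          (mfderiv 𝓘(ℝ, E4) (𝓡 4) Ψ x v))) :=
    (hg0.comp hc0).clm_bundle_apply₂ (F₁ := E4) (F₂ := E4) hT0 hW0
  rw [← contMDiff_zero_iff (I := 𝓘(ℝ, E4)) (I' := 𝓘(ℝ, ℝ))]
  intro x
  have hx := h x
  simp only [contMDiffAt_totalSpace] at hx
  exact hx.2

/-- A continuous real function without zeros on a preconnected set which is positive at one
point of the set is positive on the whole set (intermediate value theorem). [folklore] -/
theorem pos_of_isPreconnected_of_ne_zero {Y : Type*} [TopologicalSpace Y] {S : Set Y}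
    (hS : IsPreconnected S) {f : Y → ℝ} (hf : ContinuousOn f S) (hne : ∀ p ∈ S, f p ≠ 0)
    {p : Y} (hp : p ∈ S) (hfp : 0 < f p) {q : Y} (hq : q ∈ S) : 0 < f q := by
  by_contra hfq
  have hfq' : f q < 0 := lt_of_le_of_ne (not_lt.mp hfq) (hne q hq)
  obtain ⟨z, hz, hfz⟩ := hS.intermediate_value hq hp hf ⟨hfq'.le, hfp.le⟩
  exact hne z hz hfz

/-- `{x | 2M < r(x)}` is a preconnected subset of the Kerr exterior chart `{r > r₊}` (`M ≥ 0`):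
it is the continuous image of the connected chart domain `Kerr.region a (2M)`
(`Kerr.Facts.isConnected_region`, O'Neill 1995, Ch. 2, §2.1), since `2M ≥ r₊`
(`Kerr.rPlus_le_two_mul`). [cite: ONeill1995, Ch. 2 §2.1] -/
theorem Kerr_isPreconnected_setOf_two_mul_lt_radius [Kerr.Facts] {M : ℝ} (hM : 0 ≤ M) (a : ℝ) :
    IsPreconnected {x : Kerr.region a (Kerr.rPlus M a) | 2 * M < Kerr.radius a x.1} := by
  have hsubset : (Kerr.region a (2 * M) : Set E4) ⊆ Kerr.region a (Kerr.rPlus M a) :=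
    Kerr.region_mono a (Kerr.rPlus_le_two_mul (a := a) hM)
  haveI := Kerr.connectedSpace_region a (2 * M)
  have hj : Continuous fun y : Kerr.region a (2 * M) ↦
      (⟨y.1, hsubset y.2⟩ : Kerr.region a (Kerr.rPlus M a)) :=
    continuous_subtype_val.subtype_mk _
  have hr : Set.range (fun y : Kerr.region a (2 * M) ↦
      (⟨y.1, hsubset y.2⟩ : Kerr.region a (Kerr.rPlus M a))) =
      {x : Kerr.region a (Kerr.rPlus M a) | 2 * M < Kerr.radius a x.1} := by
    ext x
    constructor
    · rintro ⟨y, rfl⟩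
      exact Kerr.lt_radius_of_mem_region y.2
    · intro hx
      have hx' : 2 * M < Kerr.radius a x.1 := hx
      have h0 : (0 : ℝ) < Kerr.radius a x.1 := Kerr.radius_pos_of_mem_region x.2
      exact ⟨⟨x.1, Kerr.mem_region.2 (max_lt hx' h0)⟩, rfl⟩
  rw [← hr]
  exact isPreconnected_range hj

/-- **The backwards isometry is a local diffeomorphism of the exterior**: an involutive `C^∞`
self-map is a diffeomorphism (it is its own inverse), hence a local diffeomorphism. O'Neill 1995,
Ch. 3, §3.1. [cite: ONeill1995, Ch. 3 §3.1] -/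
theorem Kerr_isLocalDiffeomorph_exteriorMap {M a : ℝ} (h : Kerr.IsSubextremal M a) :
    IsLocalDiffeomorph 𝓘(ℝ, E4) 𝓘(ℝ, E4) ∞ (Kerr.Backwards.exteriorMap M a) :=
  Diffeomorph.isLocalDiffeomorph
    ({ toEquiv := Function.Involutive.toPerm (Kerr.Backwards.exteriorMap M a)
         Kerr.Backwards.exteriorMap_exteriorMap
       contMDiff_toFun := Kerr.Backwards.contMDiff_exteriorMap h
       contMDiff_invFun := Kerr.Backwards.contMDiff_exteriorMap h } :
      Diffeomorph 𝓘(ℝ, E4) 𝓘(ℝ, E4) (Kerr.region a (Kerr.rPlus M a))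
        (Kerr.region a (Kerr.rPlus M a)) ∞)

/-- **Pre-composition with the backwards isometry preserves local isometries into a spacetime**:
`Ψ ∘ ι` is a local diffeomorphism (composition) and
`(Ψ ∘ ι)^* g = ι^* (Ψ^* g) = ι^* g_{M,a} = g_{M,a}` (chain rule for pullbacks and
`Kerr.Backwards.isIsometricImmersion_exteriorMap`). O'Neill 1983,
Ch. 3, pp. 90–91; O'Neill 1995, Ch. 3, §3.1. [cite: ONeill1983, Ch. 3, pp. 90–91] -/
theorem isLocalIsometry_comp_exteriorMap {𝓢 : Spacetime.{0} 4} [Kerr.Facts] {M a : ℝ}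
    (h : Kerr.IsSubextremal M a) {Ψ : Kerr.region a (Kerr.rPlus M a) → 𝓢.carrier}
    (hΨ : PseudoRiemannianMetric.IsLocalIsometry
      (Kerr.smoothMetric M a (Kerr.rPlus M a)).toPseudoRiemannianMetric
      𝓢.metric.toPseudoRiemannianMetric Ψ) :
    PseudoRiemannianMetric.IsLocalIsometry
      (Kerr.smoothMetric M a (Kerr.rPlus M a)).toPseudoRiemannianMetric
      𝓢.metric.toPseudoRiemannianMetric (Ψ ∘ Kerr.Backwards.exteriorMap M a) := by
  have hιD := Kerr_isLocalDiffeomorph_exteriorMap h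
  have hΨmd : MDifferentiable 𝓘(ℝ, E4) (𝓡 4) Ψ := hΨ.1.mdifferentiable (by simp)
  have hιmd : MDifferentiable 𝓘(ℝ, E4) 𝓘(ℝ, E4) (Kerr.Backwards.exteriorMap M a) :=
    hιD.mdifferentiable (by simp)
  refine ⟨fun x ↦ (hιD x).comp _ _ (hΨ.1 _), fun y ↦ ?_⟩
  have hpb : pullbackBilin (I := 𝓡 4) (I' := 𝓘(ℝ, E4)) Ψ 𝓢.metric.toPseudoRiemannianMetric.val =
      (Kerr.smoothMetric M a (Kerr.rPlus M a)).toPseudoRiemannianMetric.val :=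
    funext hΨ.2
  rw [pullbackBilin_comp hΨmd hιmd, hpb]
  exact (Kerr.Backwards.isIsometricImmersion_exteriorMap h).2 y

/-- **Chain rule through the backwards isometry**: `d(Ψ ∘ ι)_x ∂_{t*} = −dΨ_{ι x} ∂_{t*}`
(`dι ∂_{t*} = −∂_{t*}`, `Kerr.Backwards.mfderiv_exteriorMap_stationaryField`). O'Neill 1995, §3.7.
[cite: ONeill1995, Ch. 3 §3.7] -/
theorem mfderiv_comp_exteriorMap_basisVector_zero {𝓢 : Spacetime.{0} 4} {M a : ℝ}
    (h : Kerr.IsSubextremal M a) {Ψ : Kerr.region a (Kerr.rPlus M a) → 𝓢.carrier}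
    (hΨ : MDifferentiable 𝓘(ℝ, E4) (𝓡 4) Ψ) (x : Kerr.region a (Kerr.rPlus M a)) :
    mfderiv 𝓘(ℝ, E4) (𝓡 4) (Ψ ∘ Kerr.Backwards.exteriorMap M a) x (E4.basisVector 0) =
      -(mfderiv 𝓘(ℝ, E4) (𝓡 4) Ψ (Kerr.Backwards.exteriorMap M a x) (E4.basisVector 0)) := by
  have hιmd : MDifferentiable 𝓘(ℝ, E4) 𝓘(ℝ, E4) (Kerr.Backwards.exteriorMap M a) :=
    (Kerr_isLocalDiffeomorph_exteriorMap h).mdifferentiable (by simp)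
  have he := Kerr.Backwards.mfderiv_exteriorMap_stationaryField h x
  change mfderiv 𝓘(ℝ, E4) 𝓘(ℝ, E4) (Kerr.Backwards.exteriorMap M a) x (E4.basisVector 0) =
    -(E4.basisVector 0) at he
  rw [mfderiv_comp x (hΨ _) (hιmd x)]
  -- `(dΨ ∘ dι) e₀ = dΨ (dι e₀)` definitionally (the tangent spaces of the chart are `E4`)
  change mfderiv 𝓘(ℝ, E4) (𝓡 4) Ψ (Kerr.Backwards.exteriorMap M a x)
      (mfderiv 𝓘(ℝ, E4) 𝓘(ℝ, E4) (Kerr.Backwards.exteriorMap M a) x (E4.basisVector 0)) =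
    -(mfderiv 𝓘(ℝ, E4) (𝓡 4) Ψ (Kerr.Backwards.exteriorMap M a x) (E4.basisVector 0))
  rw [he]
  exact map_neg _ _

/-! ## The orientation fix -/

/-- **The orientation fix on the chart domain `Kerr.region a r₊`** (the statement of
`orientationFix_of_subextremal` with `Kerr.exterior M a` unfolded to its definition
`Kerr.region a (Kerr.rPlus M a)`, so that all manifold instances are literally those of the chart
domain). See `orientationFix_of_subextremal`. O'Neill 1983, Ch. 5, Lemma 5.26 ff., p. 145;
O'Neill 1995, Ch. 3, §3.1. [cite: ONeill1995, Ch. 3 §3.1] -/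
theorem orientationFix_region {𝓢 : Spacetime.{0} 4} [Kerr.Facts] (O : Set 𝓢.carrier) (M a : ℝ)
    (hM : 0 < M) (ha : |a| < M)
    (hex : ∃ Ψ : Kerr.region a (Kerr.rPlus M a) → 𝓢.carrier, Function.Injective Ψ ∧
      Set.range Ψ = O ∧ PseudoRiemannianMetric.IsLocalIsometry
        (Kerr.smoothMetric M a (Kerr.rPlus M a)).toPseudoRiemannianMetric
        𝓢.metric.toPseudoRiemannianMetric Ψ) :
    ∃ Ψ : Kerr.region a (Kerr.rPlus M a) → 𝓢.carrier, Function.Injective Ψ ∧ Set.range Ψ = O ∧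
      PseudoRiemannianMetric.IsLocalIsometry
        (Kerr.smoothMetric M a (Kerr.rPlus M a)).toPseudoRiemannianMetric
        𝓢.metric.toPseudoRiemannianMetric Ψ ∧
      ∀ x : Kerr.region a (Kerr.rPlus M a), 2 * M < Kerr.radius a x.1 →
        𝓢.timeOrientation.IsFutureDirected (mfderiv 𝓘(ℝ, E4) (𝓡 4) Ψ x (E4.basisVector 0)) := by
  obtain ⟨Ψ, hinj, hrange, hΨ⟩ := hex
  have hsub : Kerr.IsSubextremal M a := ha
  have hΨmd : MDifferentiable 𝓘(ℝ, E4) (𝓡 4) Ψ := hΨ.1.mdifferentiable (by simp)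
  -- the isometry identity, fibrewise
  have hgram : ∀ (x : Kerr.region a (Kerr.rPlus M a)) (v w : E4),
      𝓢.metric.val (Ψ x) (mfderiv 𝓘(ℝ, E4) (𝓡 4) Ψ x v) (mfderiv 𝓘(ℝ, E4) (𝓡 4) Ψ x w) =
        Kerr.bilin M a x.1 v w := fun x v w ↦ by
    -- `(Ψ^* g)_x (v, w) = g (dΨ v, dΨ w)` and `(Kerr.smoothMetric M a r₊)_x = Kerr.bilin M a x`,
    -- both by `rfl`
    exact DFunLike.congr_fun (DFunLike.congr_fun (hΨ.2 x) v) w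
  -- `Ψ_* ∂_{t*}` is timelike on `{r > 2M}`
  have htl : ∀ x : Kerr.region a (Kerr.rPlus M a), 2 * M < Kerr.radius a x.1 →
      𝓢.metric.IsTimelike (mfderiv 𝓘(ℝ, E4) (𝓡 4) Ψ x (E4.basisVector 0)) := fun x hx ↦ by
    rw [LorentzianMetric.isTimelike_iff, hgram]
    exact Kerr_bilin_basisVector_zero_neg_of_lt_radius hM hx
  -- the orientation functional: continuous, nonvanishing on `{r > 2M}`, hence of one sign there
  set f : Kerr.region a (Kerr.rPlus M a) → ℝ := fun x ↦ 𝓢.metric.val (Ψ x)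
    (𝓢.timeOrientation.vectorField (Ψ x)) (mfderiv 𝓘(ℝ, E4) (𝓡 4) Ψ x (E4.basisVector 0))
    with hf_def
  have hf_cont : Continuous f :=
    continuous_val_vectorField_mfderiv_const hΨ.1.contMDiff (E4.basisVector 0)
  have hf_ne : ∀ x : Kerr.region a (Kerr.rPlus M a), 2 * M < Kerr.radius a x.1 → f x ≠ 0 :=
    fun x hx ↦ 𝓢.metric.val_ne_zero_of_isTimelike_of_isCausal
      (𝓢.timeOrientation.isTimelike (Ψ x)) (htl x hx).isCausal
  have hSpre := Kerr_isPreconnected_setOf_two_mul_lt_radius hM.le a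
  by_cases hpast : ∃ x : Kerr.region a (Kerr.rPlus M a), 2 * M < Kerr.radius a x.1 ∧ 0 < f x
  · -- the past case: `f > 0` at one point, hence on all of `{r > 2M}`; use `Ψ ∘ ι`
    obtain ⟨x₀, hx₀, hfx₀⟩ := hpast
    have hpos : ∀ x : Kerr.region a (Kerr.rPlus M a), 2 * M < Kerr.radius a x.1 → 0 < f x :=
      fun x hx ↦ pos_of_isPreconnected_of_ne_zero hSpre hf_cont.continuousOn
        (fun p hp ↦ hf_ne p hp) hx₀ hfx₀ hx
    have hιinv : Function.Involutive (Kerr.Backwards.exteriorMap M a) :=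
      Kerr.Backwards.exteriorMap_exteriorMap
    refine ⟨Ψ ∘ Kerr.Backwards.exteriorMap M a, hinj.comp hιinv.injective, ?_,
      isLocalIsometry_comp_exteriorMap hsub hΨ, fun x hx ↦ ?_⟩
    · rw [hιinv.surjective.range_comp]
      exact hrange
    · have hιx : 2 * M < Kerr.radius a (Kerr.Backwards.exteriorMap M a x).1 := by
        rw [Kerr.Backwards.coe_exteriorMap,
          Kerr.Backwards.radius_map (Kerr.radius_pos_of_mem_region x.2)]
        exact hx
      rw [mfderiv_comp_exteriorMap_basisVector_zero hsub hΨmd x]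
      exact (𝓢.timeOrientation.isFutureDirected_neg_iff _).2 ⟨(htl _ hιx).isCausal, hpos _ hιx⟩
  · -- `Ψ_* ∂_{t*}` is already future-directed on `{r > 2M}`
    have hneg : ∀ x : Kerr.region a (Kerr.rPlus M a), 2 * M < Kerr.radius a x.1 → f x < 0 :=
      fun x hx ↦ lt_of_le_of_ne (not_lt.1 fun h' ↦ hpast ⟨x, hx, h'⟩) (hf_ne x hx)
    exact ⟨Ψ, hinj, hrange, hΨ, fun x hx ↦ ⟨(htl x hx).isCausal, hneg x hx⟩⟩

/-- **Glue G4b (line `dark-future-exactness`, N1 ⇐ eternal stationary exterior rigidity):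
orientation fix.** An injective local isometry `Ψ` of the sub-extremal smooth Kerr exterior
`(Kerr.exterior M a, Kerr.smoothMetric M a r₊)`, `0 < M`, `|a| < M`, onto a region `O` of a
spacetime `𝓢` can be re-chosen with `Ψ_* ∂_{t*}` FUTURE-directed on `{r > 2M}`: there
`g(Ψ_* ∂_{t*}, Ψ_* ∂_{t*}) = −1 + 2H < 0`, so the continuous orientation functional
`g(T ∘ Ψ, Ψ_* ∂_{t*})` has one sign on the connected set `{r > 2M}`; in the past case replace `Ψ`
by `Ψ ∘ ι` with `ι = Kerr.Backwards.exteriorMap M a` the backwards isometry (`dι ∂_{t*} = −∂_{t*}`,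
`r ∘ ι = r`). O'Neill 1983, Ch. 5, Lemma 5.26 ff., p. 145; O'Neill 1995, Ch. 3, §3.1.
[cite: ONeill1995, Ch. 3 §3.1] -/
theorem orientationFix_of_subextremal : ∀ {𝓢 : Spacetime.{0} 4} [Kerr.Facts] (O : Set 𝓢.carrier) (M a : ℝ), 0 < M → |a| < M → (∃ Ψ : Kerr.exterior M a → 𝓢.carrier, Function.Injective Ψ ∧ Set.range Ψ = O ∧ PseudoRiemannianMetric.IsLocalIsometry (Kerr.smoothMetric M a (Kerr.rPlus M a)).toPseudoRiemannianMetric 𝓢.metric.toPseudoRiemannianMetric Ψ) → ∃ Ψ : Kerr.exterior M a → 𝓢.carrier, Function.Injective Ψ ∧ Set.range Ψ = O ∧ PseudoRiemannianMetric.IsLocalIsometry (Kerr.smoothMetric M a (Kerr.rPlus M a)).toPseudoRiemannianMetric 𝓢.metric.toPseudoRiemannianMetric Ψ ∧ ∀ x : Kerr.exterior M a, 2 * M < Kerr.radius a x.1 → 𝓢.timeOrientation.IsFutureDirected (mfderiv 𝓘(ℝ, E4) (𝓡 4) Ψ x (E4.basisVector 0)) := by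
  intro 𝓢 _ O M a hM ha hex
  exact orientationFix_region O M a hM ha hex

end Summit.FinalStateConjecture.FinalStateConjecture.Theorems.DarkFuture

end
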